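import Literature.AnabelianGeometry.SemiGraphs.PSCThm16iiiGeneralSigmaProofs
import Literature.AnabelianGeometry.SemiGraphs.PSCCommonPrimeUnrProofs
import HarnessLib

/-!
# [CombGC] Theorem 1.6 (iii) AS TYPED (`UnrVerticialIffHolds Ω`), every `Σ`, no displayed common prime

Mochizuki, *A combinatorial version of the Grothendieck conjecture*, Tohoku Math. J. **59** (2007)
[CombGC], Theorem 1.6 (iii), author's ms p. 13: for `G`, `H` sturdy of pro-`Σ` PSC-type and
`β : Π^unr_G ⥲ Π^unr_H`, "`β` is verticially filtration-preserving if and only if it is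
group-theoretically verticial"; proof, p. 13 l.−5…−4: "we may assume `Σ = {l}`".

Sub-DAG `plan/L3/SUBDAG-CombGC-Thm16.md`, row T16-L04d (iii) HYPOTHESIS-FREE (node CombGC:Thm1.6(iii);
FACT-LIST F-0461 `PSCDatum.UnrVerticialIffHolds`).  The closer of row T16-L04c (abc-iut-w4-d052,
`PSCThm16iiiGeneralSigmaProofs.lean`, `unrVerticialIff_holds_of_common_prime'`) proves the typed
Theorem 1.6 (iii) for all data of `Ω`-type on profinite groups and every `β`, but DISPLAYS the common prime
`l ∈ Σ_G ∩ Σ_H` through which the printed pro-`l` reduction runs (over the interface `PSCDatum`,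
[CombGC] Def. 1.1 (ii), each datum carries its own `Σ`).  The Ω-adapter of `PSCCommonPrimeUnrProofs.lean`
(abc-iut-w5-d183, `unrVerticialIff_holds_of_commonPrimeVersion`) shows that prime is AUTOMATIC: the
typed iff has the sturdiness of `G`, `H` as antecedent, and for sturdy `G` (granted [CombGC] Rmk. 1.1.3 /
1.1.5 as the origin statements `RankStatementsHold`, `UnrVertAbOfRankHolds`) the kernel
`Ker(Π_G ↠ Π^unr_G)` is a proper subgroup, so `Π^unr_G ≠ 1` is pro-`Σ_G`, and `β` transports a prime
factor of the index of a proper open normal subgroup into `Σ_H`.  Composing the two gives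

* **`unrVerticialIffHolds_of_inputs''`** — `UnrVerticialIffHolds Ω` ([CombGC] Thm. 1.6 (iii) AS TYPED
  by abc-iut-L3-t4, `PSCGraphicity.lean`: ALL `G`, `H` of `Ω`-type, EVERY `Σ_G`, `Σ_H`, every `β`) from
  the origin statements BY NAME — `RankStatementsHold` (F-3098), `VertCountLeNodeCountSuccHolds`,
  `UnrVerticialCharacterizationHolds'` (the corrected [IUTchI] Rmk. 1.2.3 (iv)), `UnrVertAbOfRankHolds`
  (F-3235), `RestrictBDOfPSCTypeHolds`, `MapAlongProLOfPSCTypeHolds`, `OpenInterDeterminesComponentHolds`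
  ([CombGC] Prop. 1.2 (i)) — and profiniteness of the data (displayed `hprof`; the interface's `proSigma`
  field constrains finite quotients only); NO displayed common prime, NO nontriviality binder;
* `unrVerticiallyFiltrationPreservingIffVerticial_of_inputs''` — the same at one pair `G`, `H`, `β`.

This is the (iii) companion of `numericallyCuspidalIff_holds_of_inputs` (Thm. 1.6 (i), F-0458,
`PSCCommonPrimeProofs.lean`).  Proof-only (0 defs); every input is an origin statement consumed by
name — a FACT row is an assumption label, nothing here asserts the printed claims for curves, and
nothing here takes a side on [IUTchIII] Cor. 3.12. [cite: MochizukiCombGC2007, Thm 1.6(iii) p.13]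
[cite: MochizukiCombGC2007, Def 1.1(ii) p.6] [cite: MochizukiCombGC2007, Rmk 1.1.5 p.8]
-/

noncomputable section

namespace Literature.AnabelianGeometry.SemiGraphs

namespace PSCDatum

universe u

section Origin

variable (Ω : PSCOrigin.{u})

/-- **[CombGC] Theorem 1.6 (iii) AS TYPED — `UnrVerticialIffHolds Ω` for ALL data of `Ω`-type on
profinite groups, EVERY `Σ`, every `β : Π^unr_G ⥲ Π^unr_H`, with NO displayed common prime**: "for `G`,
`H` sturdy, `β` is verticially filtration-preserving if and only if it is group-theoretically
verticial" (p. 13).  Inputs, all BY NAME: the origin statements of the common-prime closer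
`unrVerticialIff_holds_of_common_prime'` (row T16-L04c: the printed "we may assume `Σ = {l}`" run on the
pro-`l` shadows of the `Π^unr`-coverings) and profiniteness (`hprof`); the common prime `l ∈ Σ_G ∩ Σ_H`
it displays is supplied by `unrVerticialIff_holds_of_commonPrimeVersion` (sturdy `G` ⟹
`Ker(Π_G ↠ Π^unr_G) ≠ Π_G` ⟹ `β` carries a prime of `Σ_G` into `Σ_H`).
[cite: MochizukiCombGC2007, Thm 1.6(iii) p.13] -/
theorem unrVerticialIffHolds_of_inputs''
    (hprof : ∀ ⦃Q : Type u⦄ [Group Q] [TopologicalSpace Q] [IsTopologicalGroup Q] (K : PSCDatum Q),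
      Ω.IsOfPSCType K → CompactSpace Q ∧ TotallyDisconnectedSpace Q)
    (hrank : RankStatementsHold Ω) (hconn : VertCountLeNodeCountSuccHolds Ω)
    (hunr : UnrVerticialCharacterizationHolds' Ω) (hrankv : UnrVertAbOfRankHolds Ω)
    (hres : RestrictBDOfPSCTypeHolds Ω) (hmap : MapAlongProLOfPSCTypeHolds Ω)
    (h12 : OpenInterDeterminesComponentHolds Ω) :
    Literature.AnabelianGeometry.SemiGraphs.PSCDatum.UnrVerticialIffHolds Ω :=
  unrVerticialIff_holds_of_commonPrimeVersion Ω hprof hrank hrankv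
    (fun _ _ _ _ _ _ _ _ _ _ β hGΩ hHΩ hl => by
      obtain ⟨l, hlG, hlH⟩ := hl
      exact unrVerticialIff_holds_of_common_prime' Ω hprof hrank hconn hunr hrankv hres hmap h12
        hGΩ hHΩ hlG hlH β)

/-- **[CombGC] Theorem 1.6 (iii) at one pair**: for `G`, `H` of `Ω`-type (any `Σ_G`, `Σ_H`) and any
`β : Π^unr_G ⥲ Π^unr_H`, the typed `UnrVerticiallyFiltrationPreservingIffVerticial G H β` — "for `G`, `H`
sturdy, `β` is verticially filtration-preserving iff group-theoretically verticial" (p. 13) — from the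
same origin statements and profiniteness, with no displayed common prime.
[cite: MochizukiCombGC2007, Thm 1.6(iii) p.13] -/
theorem unrVerticiallyFiltrationPreservingIffVerticial_of_inputs''
    (hprof : ∀ ⦃Q : Type u⦄ [Group Q] [TopologicalSpace Q] [IsTopologicalGroup Q] (K : PSCDatum Q),
      Ω.IsOfPSCType K → CompactSpace Q ∧ TotallyDisconnectedSpace Q)
    (hrank : RankStatementsHold Ω) (hconn : VertCountLeNodeCountSuccHolds Ω)
    (hunr : UnrVerticialCharacterizationHolds' Ω) (hrankv : UnrVertAbOfRankHolds Ω)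
    (hres : RestrictBDOfPSCTypeHolds Ω) (hmap : MapAlongProLOfPSCTypeHolds Ω)
    (h12 : OpenInterDeterminesComponentHolds Ω)
    ⦃Q : Type u⦄ [Group Q] [TopologicalSpace Q] [IsTopologicalGroup Q]
    ⦃Q' : Type u⦄ [Group Q'] [TopologicalSpace Q'] [IsTopologicalGroup Q']
    {G : PSCDatum Q} {H : PSCDatum Q'} (hGΩ : Ω.IsOfPSCType G) (hHΩ : Ω.IsOfPSCType H)
    (β : (Q ⧸ G.unrKer) ≃ₜ* (Q' ⧸ H.unrKer)) :
    G.UnrVerticiallyFiltrationPreservingIffVerticial H β :=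
  unrVerticialIffHolds_of_inputs'' Ω hprof hrank hconn hunr hrankv hres hmap h12 G H β hGΩ hHΩ

/-- **The sturdy reading at one pair** (the printed form of Thm. 1.6 (iii), p. 13: "for `G`, `H` sturdy
…"): for STURDY `G`, `H` of `Ω`-type and any `β : Π^unr_G ⥲ Π^unr_H`, `β` is verticially
filtration-preserving if and only if it is group-theoretically verticial — the iff itself, the typed
statement's sturdiness antecedents discharged by the displayed `hGs`, `hHs`.
[cite: MochizukiCombGC2007, Thm 1.6(iii) p.13] -/
theorem isUnrVerticiallyFiltrationPreserving_iff_isUnrGroupTheoreticallyVerticial_of_inputs''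
    (hprof : ∀ ⦃Q : Type u⦄ [Group Q] [TopologicalSpace Q] [IsTopologicalGroup Q] (K : PSCDatum Q),
      Ω.IsOfPSCType K → CompactSpace Q ∧ TotallyDisconnectedSpace Q)
    (hrank : RankStatementsHold Ω) (hconn : VertCountLeNodeCountSuccHolds Ω)
    (hunr : UnrVerticialCharacterizationHolds' Ω) (hrankv : UnrVertAbOfRankHolds Ω)
    (hres : RestrictBDOfPSCTypeHolds Ω) (hmap : MapAlongProLOfPSCTypeHolds Ω)
    (h12 : OpenInterDeterminesComponentHolds Ω)
    ⦃Q : Type u⦄ [Group Q] [TopologicalSpace Q] [IsTopologicalGroup Q]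
    ⦃Q' : Type u⦄ [Group Q'] [TopologicalSpace Q'] [IsTopologicalGroup Q']
    {G : PSCDatum Q} {H : PSCDatum Q'} (hGΩ : Ω.IsOfPSCType G) (hHΩ : Ω.IsOfPSCType H)
    (hGs : G.IsSturdy) (hHs : H.IsSturdy) (β : (Q ⧸ G.unrKer) ≃ₜ* (Q' ⧸ H.unrKer)) :
    G.IsUnrVerticiallyFiltrationPreserving H β ↔ G.IsUnrGroupTheoreticallyVerticial H β :=
  unrVerticiallyFiltrationPreservingIffVerticial_of_inputs'' Ω hprof hrank hconn hunr hrankv hres hmap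
    h12 hGΩ hHΩ β hGs hHs

end Origin

end PSCDatum

end Literature.AnabelianGeometry.SemiGraphs
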